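import Literature.NumberTheory.EllipticCurves.NeronModelExistence
import HarnessLib

/-!
# Néron models are stable under base change to an open subscheme of the base

This file proves the first infrastructure lemma of the existence programme for Néron models
(`Literature.NumberTheory.EllipticCurves.NeronModelExistence`, gluing leaf
`exists_isNeronModel_of_away_of_atPrime`): **restriction of a Néron model to an open part of the
base is a Néron model**. Concretely (`IsNeronModel.pullback_specOfAlgebraMap`): let `R → R'` be
a ring map such that `Spec R' → Spec R` is an open immersion (e.g. `R' = R[1/g]`,
Mathlib `IsOpenImmersion.of_isLocalization`), and let `K` be a field with compatible algebra
structures `R → R' → K` (in the application, the common fraction field). If `𝒩 → Spec R` is a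
Néron model of the `K`-group scheme `E` (`Literature.NumberTheory.EllipticCurves.IsNeronModel`),
then the base change `𝒩 ×_R R' → Spec R'` (Mathlib's `Over.pullback`, with the group structure
transported by the monoidal functor `Over.pullback`, `Functor.grpObjObj`) is a Néron model of
`E` over `R'`.

This is the standard remark that the Néron mapping property is local on the base for the
Zariski (indeed étale) topology (Bosch–Lütkebohmert–Raynaud, *Néron Models*, §1.2, Prop. 2;
used in Silverman, *Advanced Topics*, proof of Thm. IV.6.1, p. 340: "the localization
`𝓔 ×_R R_𝔭` is a Néron model", and in Artin, *Néron Models*, proof of Thm. (1.2), p. 228). The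
proof is formal:

* smoothness, separatedness and finite type are stable under base change (Mathlib);
* generic fibre: `(𝒩 ×_R R') ×_{R'} K ≅ 𝒩 ×_R K ≅ E` *as group schemes*. The first isomorphism is
  the component at `𝒩` of `Over.pullbackComp`, a natural isomorphism between (cartesian-)monoidal
  functors, hence monoidal (Mathlib `NatTrans.IsMonoidal.of_cartesianMonoidalCategory`); the
  only subtle point is that the group structure on the iterated base change is the *iterated*
  induced one, which differs definitionally (not mathematically) from the one induced by the
  composite functor — `isMonHom_app_of_comp` handles exactly this;
* mapping property: for a smooth `R'`-scheme `𝒳'`, the composite `𝒳' → Spec R' → Spec R` is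
  smooth, `Hom_{R'}(𝒳', 𝒩 ×_R R') ≃ Hom_R(𝒳', 𝒩)` (adjunction `Over.map ⊣ Over.pullback`), and
  the generic fibres over `R'` and over `R` agree because `Spec R' → Spec R` is a monomorphism
  (`bijective_map_pullback`): `Spec K → Spec R` factors through it, so
  `𝒳' ×_{R'} K ≅ (𝒳'/R) ×_R K` (the unit of the adjunction is an isomorphism for a monomorphism,
  `isIso_mapPullbackAdj_unit_app`).

To avoid transporting along an equality of functors, the general lemmas are stated for a
morphism `a : T ⟶ S` together with a factorisation `a' ≫ φ = a` through `φ : S' ⟶ S`, and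
specialised at the end to `S = Spec R`, `S' = Spec R'`, `T = Spec K`
(`specGenericPoint_comp_specOfAlgebraMap`).

## References

* S. Bosch, W. Lütkebohmert, M. Raynaud, *Néron Models*, Springer 1990, §1.2 (Def. 1, Prop. 2).
  [BLRNeronModels1990]
* J. H. Silverman, *Advanced Topics in the Arithmetic of Elliptic Curves*, GTM 151, 1994, §IV.5
  (definition, p. 319) and proof of Thm. IV.6.1 (p. 340). [SilvermanATAEC1994]
* M. Artin, *Néron Models*, in Cornell–Silverman, *Arithmetic Geometry*, 1986, (1.1) and proof of
  Thm. (1.2), p. 228. [Artin1986NeronModels]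
-/

noncomputable section

universe u

namespace Literature.NumberTheory.EllipticCurves

open AlgebraicGeometry CategoryTheory MonObj
open scoped CategoryTheory.Obj MonoidalCategory

/-! ### Monoid morphisms and iterated monoidal functors -/

section MonoidalLemmas

open Functor.LaxMonoidal

variable {C D E : Type*} [Category C] [Category D] [Category E] [MonoidalCategory C]
  [MonoidalCategory D] [MonoidalCategory E]

/-- Let `F : C ⥤ D`, `G : D ⥤ E`, `H : C ⥤ E` be lax monoidal functors and `α : F ⋙ G ⟶ H` a
monoidal natural transformation (for the composite lax monoidal structure on `F ⋙ G`). For a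
monoid object `X` of `C`, the component `α_X : G(F X) ⟶ H X` is a morphism of monoid objects, where
`G (F X)` carries the *iterated* induced structure (`Functor.monObjObj` applied twice) and `H X`
the induced one. (Mathlib's `Functor.mapMonNatTrans` gives this for the structure induced by the
composite functor `F ⋙ G`, which agrees with the iterated one only propositionally.) [folklore] -/
theorem isMonHom_app_of_comp (F : C ⥤ D) (G : D ⥤ E) (H : C ⥤ E) [F.LaxMonoidal]
    [G.LaxMonoidal] [H.LaxMonoidal] (α : F ⋙ G ⟶ H) [NatTrans.IsMonoidal α] (X : C) [MonObj X] :
    @IsMonHom E _ _ (G.obj (F.obj X)) (H.obj X) (Functor.monObjObj (F.obj X))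
      (Functor.monObjObj X) (α.app X) := by
  refine { one_hom := ?_, mul_hom := ?_ }
  · have h₁ : ε G ≫ G.map (ε F) ≫ (α.app (𝟙_ C) : G.obj (F.obj (𝟙_ C)) ⟶ H.obj (𝟙_ C)) = ε H := by
      have := NatTrans.IsMonoidal.unit (τ := α)
      rw [comp_ε, Category.assoc] at this
      exact this
    have h₂ : G.map (F.map (η : 𝟙_ C ⟶ X)) ≫ (α.app X : G.obj (F.obj X) ⟶ H.obj X) =
        (α.app (𝟙_ C) : G.obj (F.obj (𝟙_ C)) ⟶ H.obj (𝟙_ C)) ≫ H.map η :=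
      α.naturality η
    simp only [Functor.obj.η_def, Functor.map_comp, Category.assoc]
    rw [h₂, ← h₁, Category.assoc, Category.assoc]
    rfl
  · have h₁ : «μ» G (F.obj X) (F.obj X) ≫ G.map («μ» F X X) ≫
        (α.app (X ⊗ X) : G.obj (F.obj (X ⊗ X)) ⟶ H.obj (X ⊗ X)) =
          ((α.app X : G.obj (F.obj X) ⟶ H.obj X) ⊗ₘ (α.app X : G.obj (F.obj X) ⟶ H.obj X)) ≫
            «μ» H X X := by
      have := NatTrans.IsMonoidal.tensor (τ := α) X X
      rw [comp_μ, Category.assoc] at this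
      exact this
    have h₂ : G.map (F.map (μ : X ⊗ X ⟶ X)) ≫ (α.app X : G.obj (F.obj X) ⟶ H.obj X) =
        (α.app (X ⊗ X) : G.obj (F.obj (X ⊗ X)) ⟶ H.obj (X ⊗ X)) ≫ H.map μ :=
      α.naturality μ
    simp only [Functor.obj.μ_def, Functor.map_comp, Category.assoc]
    rw [h₂]
    exact ((reassoc_of% h₁) (H.map μ)).trans (Category.assoc _ _ _)

end MonoidalLemmas

/-! ### Two successive base changes of schemes over a base -/

section TwoPullbacks

variable {S S' T : Scheme.{u}} (φ : S' ⟶ S) (a' : T ⟶ S')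

/-- Transitivity of base change, `(𝒩 ×_S S') ×_{S'} T ≅ 𝒩 ×_S T`: the component at `𝒩` of
Mathlib's `Over.pullbackComp`, typed with the iterated base change on the left. [folklore] -/
def pullbackPullbackIso (𝒩 : Over S) :
    (Over.pullback a').obj ((Over.pullback φ).obj 𝒩) ≅ (Over.pullback (a' ≫ φ)).obj 𝒩 :=
  ((Over.pullbackComp a' φ).app 𝒩).symm

/-- Naturality of `pullbackPullbackIso` in `𝒩`. [folklore] -/
theorem pullbackPullbackIso_naturality {𝒳 𝒩 : Over S} (f : 𝒳 ⟶ 𝒩) :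
    (Over.pullback a').map ((Over.pullback φ).map f) ≫ (pullbackPullbackIso φ a' 𝒩).hom =
      (pullbackPullbackIso φ a' 𝒳).hom ≫ (Over.pullback (a' ≫ φ)).map f :=
  (Over.pullbackComp a' φ).inv.naturality f

/-- For a group scheme `𝒩` over `S`, `pullbackPullbackIso : (𝒩 ×_S S') ×_{S'} T ≅ 𝒩 ×_S T` is an
isomorphism of group schemes over `T` (iterated induced structure on the left): base change is
cartesian monoidal and natural transformations of such functors are monoidal
(Mathlib `NatTrans.IsMonoidal.of_cartesianMonoidalCategory`), see `isMonHom_app_of_comp`. [folklore] -/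
theorem isMonHom_pullbackPullbackIso_hom (𝒩 : Over S) [GrpObj 𝒩] :
    IsMonHom (pullbackPullbackIso φ a' 𝒩).hom :=
  isMonHom_app_of_comp (Over.pullback φ) (Over.pullback a') (Over.pullback (a' ≫ φ))
    (Over.pullbackComp a' φ).inv 𝒩

/-- If the group scheme `𝒩 ×_S T` is isomorphic to `E` as a group scheme over `T`, where
`a = a' ≫ φ : T → S' → S`, then so is the iterated base change `(𝒩 ×_S S') ×_{S'} T`. [folklore] -/
theorem exists_iso_pullback_pullback (𝒩 : Over S) [GrpObj 𝒩] (E : Over T) [GrpObj E] {a : T ⟶ S}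
    (ha : a' ≫ φ = a) (H : ∃ e : (Over.pullback a).obj 𝒩 ≅ E, IsMonHom e.hom) :
    ∃ e : (Over.pullback a').obj ((Over.pullback φ).obj 𝒩) ≅ E, IsMonHom e.hom := by
  subst ha
  obtain ⟨e, he⟩ := H
  haveI := isMonHom_pullbackPullbackIso_hom φ a' 𝒩
  exact ⟨pullbackPullbackIso φ a' 𝒩 ≪≫ e, by rw [Iso.trans_hom]; infer_instance⟩

/-- For a monomorphism `φ : X ⟶ Y`, the functor `Over.map φ : Over X ⥤ Over Y` (composition with
`φ`) is full. [folklore] -/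
theorem full_map_of_mono {C : Type*} [Category C] {X Y : C} (φ : X ⟶ Y) [Mono φ] :
    (Over.map φ).Full where
  map_surjective {U V} k := by
    have hk : k.left ≫ V.hom = U.hom := by
      rw [← cancel_mono φ, Category.assoc]
      exact Over.w k
    exact ⟨Over.homMk k.left hk, by ext; simp⟩

/-- The functor `Over.map φ : Over X ⥤ Over Y` is faithful. [folklore] -/
theorem faithful_map {C : Type*} [Category C] {X Y : C} (φ : X ⟶ Y) : (Over.map φ).Faithful where
  map_injective {U V} f g hfg := by
    ext
    exact congr(($hfg).left)

/-- For a monomorphism `φ : X ⟶ Y`, the unit `𝒳 ⟶ (𝒳 → X → Y) ×_Y X` of the adjunction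
`Over.map φ ⊣ Over.pullback φ` is an isomorphism (a left adjoint which is fully faithful has an
invertible unit). [folklore] -/
theorem isIso_mapPullbackAdj_unit_app {C : Type*} [Category C] {X Y : C} (φ : X ⟶ Y) [Mono φ]
    [Limits.HasPullbacksAlong φ] (𝒳 : Over X) :
    IsIso ((Over.mapPullbackAdj φ).unit.app 𝒳 : 𝒳 ⟶ (Over.pullback φ).obj ((Over.map φ).obj 𝒳)) := by
  haveI := full_map_of_mono φ
  haveI := faithful_map φ
  exact (inferInstance : IsIso ((Over.mapPullbackAdj φ).unit.app 𝒳))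

variable [Mono φ]

/-- For a monomorphism `φ : S' ⟶ S` and `𝒳'` over `S'`, the unit `𝒳' ≅ (𝒳' → S' → S) ×_S S'` as an
isomorphism. [folklore] -/
def unitIso (𝒳' : Over S') : 𝒳' ≅ (Over.pullback φ).obj ((Over.map φ).obj 𝒳') :=
  @asIso _ _ _ _ ((Over.mapPullbackAdj φ).unit.app 𝒳') (isIso_mapPullbackAdj_unit_app φ 𝒳')

/-- The underlying morphism of `unitIso` is the unit of `Over.map φ ⊣ Over.pullback φ`. [folklore] -/
@[simp]
theorem unitIso_hom (𝒳' : Over S') :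
    (unitIso φ 𝒳').hom = (Over.mapPullbackAdj φ).unit.app 𝒳' := rfl

/-- For a monomorphism `φ : S' ⟶ S`, `a' : T ⟶ S'` and `𝒳'` over `S'`:
`𝒳' ×_{S'} T ≅ (𝒳' → S' → S) ×_S T` (base change of `unitIso` followed by transitivity). [folklore] -/
def pullbackMapIso (𝒳' : Over S') :
    (Over.pullback a').obj 𝒳' ≅ (Over.pullback (a' ≫ φ)).obj ((Over.map φ).obj 𝒳') :=
  (Over.pullback a').mapIso (unitIso φ 𝒳') ≪≫ pullbackPullbackIso φ a' _

/-- Compatibility of the adjunction `Over.map φ ⊣ Over.pullback φ` with base change to `T`: for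
`f : (𝒳' → S' → S) ⟶ 𝒩` over `S` with adjunct `f♭ : 𝒳' ⟶ 𝒩 ×_S S'`, the base change of `f♭` to
`T` is the base change of `f` to `T`, up to the identifications `pullbackMapIso` and
`pullbackPullbackIso` (composed form). [folklore] -/
theorem map_homEquiv_comp_eq (𝒳' : Over S') (𝒩 : Over S) (f : (Over.map φ).obj 𝒳' ⟶ 𝒩) :
    (Over.pullback a').map ((Over.mapPullbackAdj φ).homEquiv _ _ f) ≫
        (pullbackPullbackIso φ a' 𝒩).hom =
      (pullbackMapIso φ a' 𝒳').hom ≫ (Over.pullback (a' ≫ φ)).map f := by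
  have nat := pullbackPullbackIso_naturality φ a' f
  rw [Adjunction.homEquiv_unit, Functor.map_comp, Category.assoc]
  erw [nat]
  rfl

/-- `map_homEquiv_comp_eq` solved for the base change of the adjunct. [folklore] -/
theorem map_homEquiv_eq (𝒳' : Over S') (𝒩 : Over S) (f : (Over.map φ).obj 𝒳' ⟶ 𝒩) :
    (Over.pullback a').map ((Over.mapPullbackAdj φ).homEquiv _ _ f) =
      (pullbackMapIso φ a' 𝒳').hom ≫ (Over.pullback (a' ≫ φ)).map f ≫
        (pullbackPullbackIso φ a' 𝒩).inv :=
  ((Iso.eq_comp_inv _).mpr (map_homEquiv_comp_eq φ a' 𝒳' 𝒩 f)).trans (Category.assoc _ _ _)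

/-- **Transfer of a mapping property along a monomorphism of bases.** Let `φ : S' ⟶ S` be a
monomorphism, `a = a' ≫ φ : T → S' → S`, `𝒩` over `S` and `𝒳'` over `S'`. If base change to `T`
is a bijection `Hom_S(𝒳'/S, 𝒩) → Hom_T((𝒳'/S)_T, 𝒩_T)`, then base change to `T` is a bijection
`Hom_{S'}(𝒳', 𝒩 ×_S S') → Hom_T(𝒳'_T, (𝒩 ×_S S')_T)`: the two maps correspond under the adjunction
bijection `Hom_{S'}(𝒳', 𝒩 ×_S S') ≃ Hom_S(𝒳'/S, 𝒩)` and composition with the isomorphisms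
`pullbackMapIso`, `pullbackPullbackIso` (`map_homEquiv_eq`). [folklore] -/
theorem bijective_map_pullback {a : T ⟶ S} (ha : a' ≫ φ = a) (𝒩 : Over S) (𝒳' : Over S')
    (H : Function.Bijective fun f : (Over.map φ).obj 𝒳' ⟶ 𝒩 => (Over.pullback a).map f) :
    Function.Bijective
      fun f' : 𝒳' ⟶ (Over.pullback φ).obj 𝒩 => (Over.pullback a').map f' := by
  subst ha
  have hfun : (fun f' : 𝒳' ⟶ (Over.pullback φ).obj 𝒩 => (Over.pullback a').map f') =
      (fun g => (pullbackMapIso φ a' 𝒳').hom ≫ g ≫ (pullbackPullbackIso φ a' 𝒩).inv) ∘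
        (fun f : (Over.map φ).obj 𝒳' ⟶ 𝒩 => (Over.pullback (a' ≫ φ)).map f) ∘
          ((Over.mapPullbackAdj φ).homEquiv 𝒳' 𝒩).symm := by
    funext f'
    obtain ⟨f, rfl⟩ := ((Over.mapPullbackAdj φ).homEquiv 𝒳' 𝒩).surjective f'
    simp only [Function.comp_apply, Equiv.symm_apply_apply]
    exact map_homEquiv_eq φ a' 𝒳' 𝒩 f
  rw [hfun]
  exact (Iso.homCongr (pullbackMapIso φ a' 𝒳').symm (pullbackPullbackIso φ a' 𝒩).symm).bijective.comp
    (H.comp (Equiv.bijective _))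

end TwoPullbacks

/-! ### Néron models restrict to open subschemes of the base -/

section BaseChange

variable {R : Type u} [CommRing R] {K : Type u} [Field K] [Algebra R K]
  {R' : Type u} [CommRing R'] [Algebra R R'] [Algebra R' K] [IsScalarTower R R' K]

variable (R R') in
/-- The morphism of affine schemes `Spec R' ⟶ Spec R` induced by an algebra `R → R'`. [folklore] -/
abbrev specOfAlgebraMap : Spec (.of R') ⟶ Spec (.of R) :=
  Spec.map (CommRingCat.ofHom (algebraMap R R'))

variable (R K R') in
/-- For a tower `R → R' → K`, the generic point `Spec K → Spec R` factors as
`Spec K → Spec R' → Spec R`. [folklore] -/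
theorem specGenericPoint_comp_specOfAlgebraMap :
    specGenericPoint R' K ≫ specOfAlgebraMap R R' = specGenericPoint R K := by
  simp only [specGenericPoint, specOfAlgebraMap, ← Spec.map_comp, ← CommRingCat.ofHom_comp,
    ← IsScalarTower.algebraMap_eq R R' K]

variable {𝒩 : Over (Spec (.of R))} [GrpObj 𝒩] {E : Over (Spec (.of K))} [GrpObj E]

/-- **Néron models restrict to open subschemes of the base** (the Néron mapping property is local
on the base: Bosch–Lütkebohmert–Raynaud, *Néron Models*, §1.2, Prop. 2; Silverman, *ATAEC*,
proof of Thm. IV.6.1, p. 340; Artin, proof of Thm. (1.2), p. 228). Let `R → R' → K` be a tower of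
algebras with `K` a field such that `Spec R' → Spec R` is an open immersion (e.g. `R' = R[1/g]`,
`IsOpenImmersion.of_isLocalization`). If the `R`-group scheme `𝒩` is a Néron model of the
`K`-group scheme `E`, then its base change `𝒩 ×_R R'` — Mathlib's
`(Over.pullback (Spec R' → Spec R)).obj 𝒩` with the induced group structure — is a Néron model
of `E` over `R'`. Proof: smooth/separated/finite type are stable under base change; the generic
fibre is `(𝒩 ×_R R')_K ≅ 𝒩_K ≅ E` as group schemes (`exists_iso_pullback_pullback`); the mapping
property for a smooth `R'`-scheme `𝒳'` is that of `𝒩` for the smooth `R`-scheme `𝒳' → Spec R'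
→ Spec R`, transferred by `bijective_map_pullback` (an open immersion is a smooth monomorphism).
[cite: SilvermanATAEC1994, proof of Thm. IV.6.1 (p. 340)] -/
theorem IsNeronModel.pullback_specOfAlgebraMap [IsOpenImmersion (specOfAlgebraMap R R')]
    (h : IsNeronModel R K 𝒩 E) :
    IsNeronModel R' K ((Over.pullback (specOfAlgebraMap R R')).obj 𝒩) E where
  smooth := by
    change Smooth (Limits.pullback.snd 𝒩.hom (specOfAlgebraMap R R'))
    exact MorphismProperty.pullback_snd _ _ h.smooth
  isSeparated := by
    change IsSeparated (Limits.pullback.snd 𝒩.hom (specOfAlgebraMap R R'))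
    exact MorphismProperty.pullback_snd _ _ h.isSeparated
  locallyOfFiniteType := by
    change LocallyOfFiniteType (Limits.pullback.snd 𝒩.hom (specOfAlgebraMap R R'))
    exact MorphismProperty.pullback_snd _ _ h.locallyOfFiniteType
  quasiCompact := by
    change QuasiCompact (Limits.pullback.snd 𝒩.hom (specOfAlgebraMap R R'))
    exact MorphismProperty.pullback_snd _ _ h.quasiCompact
  exists_iso := exists_iso_pullback_pullback (specOfAlgebraMap R R') (specGenericPoint R' K) 𝒩 E
    (specGenericPoint_comp_specOfAlgebraMap R K R') h.exists_iso
  mappingProperty 𝒳' h𝒳' := by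
    have hsm : Smooth ((Over.map (specOfAlgebraMap R R')).obj 𝒳').hom := by
      change Smooth (𝒳'.hom ≫ specOfAlgebraMap R R')
      exact MorphismProperty.comp_mem _ _ _ h𝒳' inferInstance
    exact bijective_map_pullback (specOfAlgebraMap R R') (specGenericPoint R' K)
      (specGenericPoint_comp_specOfAlgebraMap R K R') 𝒩 𝒳' (h.mappingProperty _ hsm)

/-- **Néron models localize to basic open subsets of the base**: for `g ∈ R` and any
`R`-algebra model `R'` of `R[1/g]` mapping compatibly to `K`, a Néron model of `E` over `R` base
changes to a Néron model of `E` over `R'` (`IsNeronModel.pullback_specOfAlgebraMap` with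
Mathlib's `IsOpenImmersion.of_isLocalization`). [cite: SilvermanATAEC1994, proof of Thm. IV.6.1 (p. 340)] -/
theorem IsNeronModel.pullback_away (g : R) [IsLocalization.Away g R'] (h : IsNeronModel R K 𝒩 E) :
    IsNeronModel R' K ((Over.pullback (specOfAlgebraMap R R')).obj 𝒩) E :=
  haveI : IsOpenImmersion (specOfAlgebraMap R R') := IsOpenImmersion.of_isLocalization g
  h.pullback_specOfAlgebraMap

/-- Existence form: if `E` has a Néron model over `R`, it has one over every `R`-algebra `R'`
(compatibly mapping to `K`) with `Spec R' → Spec R` an open immersion. [cite: SilvermanATAEC1994, proof of Thm. IV.6.1 (p. 340)] -/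
theorem exists_isNeronModel_of_isOpenImmersion [IsOpenImmersion (specOfAlgebraMap R R')]
    (E : Over (Spec (.of K))) [GrpObj E]
    (h : ∃ 𝒩 : Grp (Over (Spec (.of R))), IsNeronModel R K 𝒩.X E) :
    ∃ 𝒩' : Grp (Over (Spec (.of R'))), IsNeronModel R' K 𝒩'.X E := by
  obtain ⟨𝒩, h𝒩⟩ := h
  exact ⟨⟨(Over.pullback (specOfAlgebraMap R R')).obj 𝒩.X⟩, h𝒩.pullback_specOfAlgebraMap⟩

end BaseChange

end Literature.NumberTheory.EllipticCurves

end
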